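import Mathlib
import HarnessLib
import Summits.Ventures.LatticeQCDFlow.Exactness.NCMCGeneralSpaceRestartChainDilution

/-!
# NCMCGeneralSpaceRestartChainAutocorrelationEnvelope — the printed lag-`t` autocorrelation of a
# record observable along the restart chain is at most `α·(1 − ε)^t`: the DILUTION times the level
# sampler's Doeblin residual — the number the row reads off its weight series

HONEST FRAMING: exact (Metropolis-corrected) sampling algorithms for lattice gauge theory;
figures of merit are autocorrelation/cost numbers at stated couplings and volumes; no
continuum-physics claim.

Venture `LatticeQCDFlow` (cell pub-lqcd); FANOUT row 19 (`su2-snf`, GEN-9).  OUR WORK; nothing is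
cited as a fact.  `Exactness/NCMCGeneralSpaceRestartChainDilution` proves the dilution law
`autocov R P_F G (t+1) = autocov K ν̄₀ h (t+1)` (`h = E[G | start]`) and uses, inside the variance-of-sums
proof, the Doeblin envelope of the level sampler on the centred record mean.  This file exports that
per-lag statement, which is what a seat compares with the MEASURED autocorrelation of the Jarzynski
weights along the restart chain (row 19's desk datum HOME/su2-snf/xcheck/launch-gen9: all eight F1/F2
arms show `ρ_w(1) ≈ 0`).

* **`CrooksPair.abs_autocov_restartChain_succ_le`** — Crooks pair, `K` Markov `ν₀`-invariant with
  `ε·(Z₀⁻¹ν₀)(B) ≤ K(z, B)`; `G` bounded measurable, `Ḡ = G − E_{P_F}G`, `h(z) = ∫ G dκF(z,·)`: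
  `|autocov R P_F Ḡ (t+1)| ≤ (1 − ε)^{t+1}·Var_{Z₀⁻¹ν₀} h` for every `t`;
* **`CrooksPair.abs_autocov_restartChain_succ_le_of_dilution`** — with `Var h ≤ α·Var_{P_F} G`:
  `|autocov R P_F Ḡ (t+1)| ≤ α·(1 − ε)^{t+1}·Var_{P_F} G`, i.e. the lag-`(t+1)` autocorrelation
  `ρ_G(t+1) = autocov/Var` is at most `α(1 − ε)^{t+1}` in absolute value.

Reading (value-free): with the level sampler = `m` sweeps of a one-sweep-minorised kernel,
`1 − ε_m = (1 − ε₁)^m` (`Exactness/NCMCGeneralSpaceDoeblinGeometric`), so `|ρ_w(1)| ≤ α·q^{n_between}`,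
`q = 1 − ε₁`: the measured lag-1 weight autocorrelation is a LOWER bound for the envelope number
`α·q^{n_between}` that `Scaling/LaunchIntervalLaw` and `…SampleSizeDilution` consume.  NOT CLAIMED:
the converse (a small `ρ_w(1)` does not certify a small `α`).
-/

namespace Summit.Ventures.LatticeQCDFlow.Exactness.GeneralNCMC

open MeasureTheory ProbabilityTheory Set Filter Finset
open scoped ENNReal

variable {Ω E : Type*} [MeasurableSpace Ω] [MeasurableSpace E]

namespace CrooksPair

variable {ν₀ ν₁ : Measure Ω} [IsFiniteMeasure ν₀] [IsFiniteMeasure ν₁] {κF κR : Kernel Ω E}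
  [IsMarkovKernel κF] [IsMarkovKernel κR] {s e : E → Ω} {W : E → ℝ}

omit [IsFiniteMeasure ν₁] [IsMarkovKernel κR] in
/-- **THE AUTOCORRELATION ENVELOPE ALONG THE RESTART CHAIN**: for every bounded measurable record
observable `G` (centred at its `P_F`-mean) and every `t`,
`|autocov R P_F (G − E G) (t+1)| ≤ (1 − ε)^{t+1}·Var_{Z₀⁻¹ν₀}(E[G | start])`. [ours] -/
theorem abs_autocov_restartChain_succ_le (K : Kernel Ω Ω) [IsMarkovKernel K]
    (h0 : ν₀ univ ≠ 0) (hK : Kernel.Invariant K ν₀) (h : CrooksPair ν₀ ν₁ κF κR s e W)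
    {ε : ℝ≥0∞}
    (hmin : ∀ z (B : Set Ω), MeasurableSet B → ε * ((ν₀ univ)⁻¹ • ν₀) B ≤ K z B)
    {G : E → ℝ} (hG : Measurable G) {C : ℝ} (hC : ∀ ω, |G ω| ≤ C) (t : ℕ) :
    haveI := isProbabilityMeasure_fwdPathLaw ν₀ h0 κF
    |Scoring.autocov ((κF ∘ₖ K).comap s h.measurable_s) (fwdPathLaw ν₀ κF)
        (fun ω => G ω - ∫ ω', G ω' ∂(fwdPathLaw ν₀ κF)) (t + 1)|
      ≤ (1 - ε.toReal) ^ (t + 1) * Var[fun z => ∫ ω, G ω ∂(κF z); (ν₀ univ)⁻¹ • ν₀] := by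
  haveI := isProbabilityMeasure_fwdPathLaw ν₀ h0 κF
  haveI : IsProbabilityMeasure ((ν₀ univ)⁻¹ • ν₀) := by
    constructor
    rw [Measure.smul_apply, smul_eq_mul, ENNReal.inv_mul_cancel h0 (measure_ne_top _ _)]
  set θ := ∫ ω, G ω ∂(fwdPathLaw ν₀ κF) with hθ
  have hπK : Kernel.Invariant K ((ν₀ univ)⁻¹ • ν₀) := invariant_smul K hK _
  have hgm : Measurable fun ω => G ω - θ := hG.sub measurable_const
  have hgb : ∀ ω, |G ω - θ| ≤ C + |θ| := fun ω => (abs_sub _ _).trans (add_le_add (hC ω) le_rfl)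
  have hhm := measurable_recordMean κF hG
  have hhb := abs_recordMean_le κF hC
  have hhcm : Measurable fun z => ∫ ω, (G ω - θ) ∂(κF z) := measurable_recordMean κF hgm
  have hhcb : ∀ z, |∫ ω, (G ω - θ) ∂(κF z)| ≤ C + |θ| := abs_recordMean_le κF hgb
  have hrec : ∀ z, ∫ ω, (G ω - θ) ∂(κF z) = ∫ ω, G ω ∂(κF z) - θ := fun z => by
    rw [integral_sub (Scoring.integrable_of_bounded _ hG hC) (integrable_const _), integral_const,
      probReal_univ, one_smul]
  have hmean : ∫ z, (∫ ω, G ω ∂(κF z)) ∂((ν₀ univ)⁻¹ • ν₀) = θ := integral_recordMean_fwdPathLaw hG hC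
  have hhc0 : ∫ z, (∫ ω, (G ω - θ) ∂(κF z)) ∂((ν₀ univ)⁻¹ • ν₀) = 0 := by
    simp_rw [hrec]
    rw [integral_sub (Scoring.integrable_of_bounded _ hhm hhb) (integrable_const _), hmean,
      integral_const, probReal_univ, one_smul, sub_self]
  have hvarh : ∫ z, (∫ ω, (G ω - θ) ∂(κF z)) ^ 2 ∂((ν₀ univ)⁻¹ • ν₀)
      = Var[fun z => ∫ ω, G ω ∂(κF z); (ν₀ univ)⁻¹ • ν₀] := by
    rw [variance_eq_integral hhm.aemeasurable]
    refine integral_congr_ae (Eventually.of_forall fun z => ?_)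
    simp only
    rw [hrec z, hmean]
  rw [h.autocov_restartKernel_succ K hgm hgb t, ← hvarh]
  exact Scoring.abs_autocov_le_of_doeblin hπK (fun x B hB => hmin x B hB) hhcm hhcb hhc0 (t + 1)

omit [IsFiniteMeasure ν₁] [IsMarkovKernel κR] in
/-- **With a dilution constant**: `Var_{Z₀⁻¹ν₀}(E[G|start]) ≤ α·Var_{P_F} G` ⇒
`|autocov R P_F (G − E G) (t+1)| ≤ α·(1 − ε)^{t+1}·Var_{P_F} G` — the lag-`(t+1)` autocorrelation of
`G` along the restart chain is at most `α(1−ε)^{t+1}`. [ours] -/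
theorem abs_autocov_restartChain_succ_le_of_dilution (K : Kernel Ω Ω) [IsMarkovKernel K]
    (h0 : ν₀ univ ≠ 0) (hK : Kernel.Invariant K ν₀) (h : CrooksPair ν₀ ν₁ κF κR s e W)
    {ε : ℝ≥0∞}
    (hmin : ∀ z (B : Set Ω), MeasurableSet B → ε * ((ν₀ univ)⁻¹ • ν₀) B ≤ K z B)
    {G : E → ℝ} (hG : Measurable G) {C : ℝ} (hC : ∀ ω, |G ω| ≤ C) {α : ℝ}
    (hα : Var[fun z => ∫ ω, G ω ∂(κF z); (ν₀ univ)⁻¹ • ν₀] ≤ α * Var[G; fwdPathLaw ν₀ κF])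
    (t : ℕ) :
    haveI := isProbabilityMeasure_fwdPathLaw ν₀ h0 κF
    |Scoring.autocov ((κF ∘ₖ K).comap s h.measurable_s) (fwdPathLaw ν₀ κF)
        (fun ω => G ω - ∫ ω', G ω' ∂(fwdPathLaw ν₀ κF)) (t + 1)|
      ≤ α * (1 - ε.toReal) ^ (t + 1) * Var[G; fwdPathLaw ν₀ κF] := by
  haveI : IsProbabilityMeasure ((ν₀ univ)⁻¹ • ν₀) := by
    constructor
    rw [Measure.smul_apply, smul_eq_mul, ENNReal.inv_mul_cancel h0 (measure_ne_top _ _)]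
  have h1 := h.abs_autocov_restartChain_succ_le K h0 hK hmin hG hC t
  have hl0 : 0 ≤ 1 - ε.toReal :=
    Scoring.one_sub_toReal_nonneg_of_doeblin (κ := K) (π := (ν₀ univ)⁻¹ • ν₀)
      (fun x B hB => hmin x B hB)
  refine h1.trans ?_
  calc (1 - ε.toReal) ^ (t + 1) * Var[fun z => ∫ ω, G ω ∂(κF z); (ν₀ univ)⁻¹ • ν₀]
      ≤ (1 - ε.toReal) ^ (t + 1) * (α * Var[G; fwdPathLaw ν₀ κF]) :=
        mul_le_mul_of_nonneg_left hα (pow_nonneg hl0 _)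
    _ = α * (1 - ε.toReal) ^ (t + 1) * Var[G; fwdPathLaw ν₀ κF] := by ring

end CrooksPair

end Summit.Ventures.LatticeQCDFlow.Exactness.GeneralNCMC
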